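import Summits.Ventures.HodgeRepro2.T5GramIsometry

/-!
# The real places of the rank-2 diagonal forms: equal sign sums ⇒ congruent over `ℂ` — the chain consumes
seat t6-p5's signature hypothesis (cell pub-hodge-repro2, seat p3)

Tier-5 N2 support, row N2.8.1 (iii) / Lemma N.1. File 156's chain takes the real-place input as
`hreal : ∀ φ : K →+* ℂ, IsCongruent (H.map φ) (H'.map φ)`; seat t6-p5's display `T6.Hyp.Shimura2008_Thm2_2_i K`
states the same input for the datum's diagonal forms `pairForm c₁ c₂`, `pairForm c₁' c₂'` as the equality of the
sign sums `sign (φ c₁).re + sign (φ c₂).re = sign (φ c₁').re + sign (φ c₂').re` (Shimura's index `s_v(ϕ) = p_v − q_v`).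
This file shows the two are the same thing for rank-2 diagonal forms with totally real coefficients:

* `isCongruent_diagonal_swap`: `diag(x, y) ≅ diag(y, x)`;
* `isCongruent_diagonal_sign`: over `ℂ`, `diag(r, s) ≅ diag(sign r, sign s)` for non-zero real `r, s`
  (`P = diag(1/√|r|, 1/√|s|)`);
* **`isCongruent_diagonal_of_sign_add`**: equal sign sums ⇒ congruent (the four sign patterns, a swap at most);
* `map_diagonal_eq`, **`isCongruent_map_of_sign_add`**: for totally real `cᵢ` of the CM field `K` (`star cᵢ = cᵢ`),
  the sign-sum condition under `φ : K →+* ℂ` gives `IsCongruent ((diagonal ![c₁', c₂']).map φ) ((diagonal ![c₁, c₂]).map φ)`;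
* **`exists_isometry_pairForm_of_chain_signs`**: file 156's chain concluded in t6-p5's shape FROM t6-p5's own
  hypothesis list (`star cᵢ = cᵢ`, `cᵢ ≠ 0`, the sign sums) with the global norm condition `c₁ c₂ ≡ c₁' c₂'
  mod N(K^×)` REPLACED by the local data (`hodd`, `|D| ≤ 1`) and the two displays (71:18; Landherr's uniqueness).

Mathlib + this seat's files 134 / 156 / 157 and their imports; no display; no device.
§8(d): uses an L-value-free non-vanishing device: NO.
-/

namespace Summit.Ventures.HodgeRepro2.T5GramSignature

open Matrix Summit.Ventures.HodgeRepro2.T5HermitianDetClass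
open scoped ComplexConjugate

section Swap

variable {E : Type*} [CommRing E] [StarRing E]

/-- `diag(x, y) ≅ diag(y, x)` (the swap matrix). -/
theorem isCongruent_diagonal_swap (x y : E) : IsCongruent (diagonal ![x, y]) (diagonal ![y, x]) := by
  refine ⟨!![0, 1; 1, 0], ?_, ?_⟩
  · rw [det_fin_two_of, mul_zero, one_mul, zero_sub]
    exact isUnit_one.neg
  · ext i j
    fin_cases i <;> fin_cases j <;>
      simp [Matrix.mul_apply, Fin.sum_univ_two, conjTranspose_apply, diagonal_apply]

end Swap

section Complex

/-- `(1/√|t|) · t · (1/√|t|) = sign t` for a non-zero real `t`. -/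
theorem inv_sqrt_abs_mul_mul (t : ℝ) (ht : t ≠ 0) :
    (Real.sqrt |t|)⁻¹ * t * (Real.sqrt |t|)⁻¹ = (SignType.sign t : ℝ) := by
  have habs : |t| ≠ 0 := abs_ne_zero.mpr ht
  have hsq : Real.sqrt |t| * Real.sqrt |t| = |t| := Real.mul_self_sqrt (abs_nonneg t)
  have h2 : (Real.sqrt |t|)⁻¹ * (Real.sqrt |t|)⁻¹ = |t|⁻¹ := by rw [← mul_inv, hsq]
  have h1 : (Real.sqrt |t|)⁻¹ * t * (Real.sqrt |t|)⁻¹ = t / |t| := by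
    rw [div_eq_mul_inv, ← h2]
    ring
  rw [h1, eq_comm, eq_div_iff habs]
  exact sign_mul_abs t

/-- `√|t| ≠ 0` for `t ≠ 0`. -/
theorem sqrt_abs_ne_zero (t : ℝ) (ht : t ≠ 0) : Real.sqrt |t| ≠ 0 :=
  (Real.sqrt_pos.mpr (abs_pos.mpr ht)).ne'

/-- **Scaling to the signs:** over `ℂ`, `diag(r, s) ≅ diag(sign r, sign s)` for non-zero real `r, s`. -/
theorem isCongruent_diagonal_sign (r s : ℝ) (hr : r ≠ 0) (hs : s ≠ 0) :
    IsCongruent (diagonal ![(r : ℂ), (s : ℂ)])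
      (diagonal ![((SignType.sign r : ℝ) : ℂ), ((SignType.sign s : ℝ) : ℂ)]) := by
  refine ⟨diagonal ![(((Real.sqrt |r|)⁻¹ : ℝ) : ℂ), (((Real.sqrt |s|)⁻¹ : ℝ) : ℂ)], ?_, ?_⟩
  · rw [det_diagonal, Fin.prod_univ_two]
    simp only [Matrix.cons_val_zero, Matrix.cons_val_one]
    refine (isUnit_iff_ne_zero.mpr ?_).mul (isUnit_iff_ne_zero.mpr ?_)
    · exact Complex.ofReal_ne_zero.mpr (inv_ne_zero (sqrt_abs_ne_zero r hr))
    · exact Complex.ofReal_ne_zero.mpr (inv_ne_zero (sqrt_abs_ne_zero s hs))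
  · rw [diagonal_conjTranspose, diagonal_mul_diagonal, diagonal_mul_diagonal]
    congr 1
    ext i
    fin_cases i
    · simp only [Fin.zero_eta, Fin.isValue, Pi.star_apply, Matrix.cons_val_zero, Complex.star_def,
        Complex.conj_ofReal]
      exact_mod_cast inv_sqrt_abs_mul_mul r hr
    · simp only [Fin.mk_one, Fin.isValue, Pi.star_apply, Matrix.cons_val_one, Matrix.cons_val_zero,
        Complex.star_def, Complex.conj_ofReal]
      exact_mod_cast inv_sqrt_abs_mul_mul s hs

/-- `sign t ∈ {1, −1}` for `t ≠ 0`. -/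
theorem sign_eq_one_or_neg_one (t : ℝ) (ht : t ≠ 0) : SignType.sign t = 1 ∨ SignType.sign t = -1 := by
  rcases lt_or_gt_of_ne ht with h | h
  · exact Or.inr (sign_neg h)
  · exact Or.inl (sign_pos h)

/-- **Equal sign sums ⇒ congruent over `ℂ`** (rank 2, non-zero real entries): `diag(a', b') ≅ diag(a, b)` when
`sign a + sign b = sign a' + sign b'` — the sign patterns agree up to a swap. -/
theorem isCongruent_diagonal_of_sign_add {a b a' b' : ℝ} (ha : a ≠ 0) (hb : b ≠ 0) (ha' : a' ≠ 0) (hb' : b' ≠ 0)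
    (h : (SignType.sign a : ℤ) + SignType.sign b = (SignType.sign a' : ℤ) + SignType.sign b') :
    IsCongruent (diagonal ![(a' : ℂ), (b' : ℂ)]) (diagonal ![(a : ℂ), (b : ℂ)]) := by
  refine (isCongruent_diagonal_sign a' b' ha' hb').trans
    (IsCongruent.trans ?_ (isCongruent_diagonal_sign a b ha hb).symm)
  rcases sign_eq_one_or_neg_one a ha with hsa | hsa <;> rcases sign_eq_one_or_neg_one b hb with hsb | hsb <;>
    rcases sign_eq_one_or_neg_one a' ha' with hsa' | hsa' <;>
    rcases sign_eq_one_or_neg_one b' hb' with hsb' | hsb' <;>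
    rw [hsa, hsb, hsa', hsb'] at h ⊢ <;>
    simp only [SignType.coe_one, SignType.coe_neg_one, Complex.ofReal_one, Complex.ofReal_neg] at h ⊢ <;>
    first
    | exact isCongruent_refl _
    | exact isCongruent_diagonal_swap _ _
    | (exfalso; norm_num at h)

end Complex

section CMField

open NumberField NumberField.IsCMField

variable {K : Type*} [Field K] [NumberField K] [IsCMField K]

/-- A totally real element of the CM field (`star c = c`) is real under every embedding: `φ c = (φ c).re`. -/
theorem ofReal_re_eq (φ : K →+* ℂ) {c : K} (hc : star c = c) : (((φ c).re : ℝ) : ℂ) = φ c := by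
  refine Complex.conj_eq_iff_re.mp ?_
  rw [← complexEmbedding_complexConj K φ c]
  exact congrArg φ hc

/-- `(φ c).re ≠ 0` for a non-zero totally real `c`. -/
theorem re_ne_zero (φ : K →+* ℂ) {c : K} (hc : star c = c) (hc0 : c ≠ 0) : (φ c).re ≠ 0 := by
  intro h
  apply (map_ne_zero φ).mpr hc0
  rw [← ofReal_re_eq φ hc, h, Complex.ofReal_zero]

/-- The image of `diag(c₁, c₂)` under `φ` is the real diagonal matrix `diag((φ c₁).re, (φ c₂).re)`. -/
theorem map_diagonal_eq (φ : K →+* ℂ) {c₁ c₂ : K} (h₁ : star c₁ = c₁) (h₂ : star c₂ = c₂) :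
    (diagonal ![c₁, c₂]).map φ = diagonal ![(((φ c₁).re : ℝ) : ℂ), (((φ c₂).re : ℝ) : ℂ)] := by
  rw [diagonal_map (map_zero φ)]
  congr 1
  ext i
  fin_cases i
  · exact (ofReal_re_eq φ h₁).symm
  · exact (ofReal_re_eq φ h₂).symm

/-- **Seat t6-p5's signature hypothesis gives file 156's real-place input:** for totally real, non-zero
`c₁ c₂ c₁' c₂'`, equal sign sums under `φ : K →+* ℂ` give `IsCongruent` of the images of the two diagonal Gram
matrices. -/
theorem isCongruent_map_of_sign_add (φ : K →+* ℂ) {c₁ c₂ c₁' c₂' : K}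
    (h₁ : star c₁ = c₁) (h₂ : star c₂ = c₂) (h₁' : star c₁' = c₁') (h₂' : star c₂' = c₂')
    (hc₁ : c₁ ≠ 0) (hc₂ : c₂ ≠ 0) (hc₁' : c₁' ≠ 0) (hc₂' : c₂' ≠ 0)
    (h : (SignType.sign (φ c₁).re : ℤ) + SignType.sign (φ c₂).re =
      (SignType.sign (φ c₁').re : ℤ) + SignType.sign (φ c₂').re) :
    IsCongruent ((diagonal ![c₁', c₂']).map φ) ((diagonal ![c₁, c₂]).map φ) := by
  rw [map_diagonal_eq φ h₁' h₂', map_diagonal_eq φ h₁ h₂]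
  exact isCongruent_diagonal_of_sign_add (re_ne_zero φ h₁ hc₁) (re_ne_zero φ h₂ hc₂) (re_ne_zero φ h₁' hc₁')
    (re_ne_zero φ h₂' hc₂') h

open IsDedekindDomain IsDedekindDomain.HeightOneSpectrum Summit.Ventures.HodgeRepro2.T5HermitianGlobalChain
  Summit.Ventures.HodgeRepro2.T5GramIsometry Summit.Ventures.HodgeRepro2.T5DatumSimilitude

variable {θ : maximalRealSubfield K} {y : K}
  (hθ : algebraMap (maximalRealSubfield K) K θ = y ^ 2) (hy : complexConj K y ≠ y)

include hθ hy in
/-- **File 156's chain in seat t6-p5's shape, from t6-p5's own hypothesis list:** totally real non-zero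
`c₁ c₂ c₁' c₂'` with equal sign sums under every `φ : K →+* ℂ` (the real places), the selection-rule input
`hodd` at the odd non-split places, `|D| ≤ 1`, Hilbert reciprocity (t6-p4's display) and Landherr's uniqueness
(file 156's display) give `g : K × K ≃ₗ[K] K × K` with `pairForm c₁' c₂' (g v) (g w) = pairForm c₁ c₂ v w` —
the conclusion of `Shimura2008_Thm2_2_i` with its global norm condition replaced by local data and reciprocity. -/
theorem exists_isometry_pairForm_of_chain_signs {c₁ c₂ c₁' c₂' : K}
    (h₁ : star c₁ = c₁) (h₂ : star c₂ = c₂) (h₁' : star c₁' = c₁') (h₂' : star c₂' = c₂')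
    (hc₁ : c₁ ≠ 0) (hc₂ : c₂ ≠ 0) (hc₁' : c₁' ≠ 0) (hc₂' : c₂' ≠ 0)
    (hsign : ∀ φ : K →+* ℂ, (SignType.sign (φ c₁).re : ℤ) + SignType.sign (φ c₂).re =
      (SignType.sign (φ c₁').re : ℤ) + SignType.sign (φ c₂').re)
    (hodd : ∀ v : HeightOneSpectrum (𝓞 (maximalRealSubfield K)),
      ¬ IsSquare (algebraMap (maximalRealSubfield K) (v.adicCompletion (maximalRealSubfield K)) θ) →
      IsUnit (2 : adicCompletionIntegers (maximalRealSubfield K) v) →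
      LocallyCongruent K v (diagonal ![c₁', c₂']) (diagonal ![c₁, c₂]))
    (hD : (dyadicNonSplit K (θ := θ)).Subsingleton)
    (hrec : Summit.Ventures.HodgeRepro2.T6.Hyp.OMeara1963_71_18 (maximalRealSubfield K))
    (hLandherr : GrossBH2021_Thm3_1_uniqueness K (Fin 2)) :
    ∃ g : (K × K) ≃ₗ[K] (K × K), ∀ v w, pairForm c₁' c₂' (g v) (g w) = pairForm c₁ c₂ v w :=
  exists_isometry_pairForm_of_chain hθ hy h₁ h₂ h₁' h₂' hc₁ hc₂ hc₁' hc₂' hodd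
    (fun φ => isCongruent_map_of_sign_add φ h₁ h₂ h₁' h₂' hc₁ hc₂ hc₁' hc₂' (hsign φ)) hD hrec hLandherr

end CMField

end Summit.Ventures.HodgeRepro2.T5GramSignature
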